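import Summits.CriticalPhenomena.PercolationContinuityZ3.Theorems.Transplant.SiteKNWitness
import Summits.CriticalPhenomena.PercolationContinuityZ3.Theorems.Transplant.SiteKNUnconditional
import Summits.CriticalPhenomena.PercolationContinuityZ3.Theorems.Transplant.SiteSamePWitnessAtOne
import HarnessLib

/-!
# SITE percolation on `ℤ^d`, `d ≥ 3`: `θ^{site}(p_c^{site}) = 0` — the closed theorem (lane `prim-bschramm`, class C1a)

builds on p205010 (kernel theorem, internal audit signed; external expert review pending).
The assembly of the SITE re-typing of Kozma–Nitzan §4: block (α) — the site Lemma 10 as the site target property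
(`SiteKN.siteTargetProperty_of_theta`, prim-bschramm p1 gen 3, `Transplant/SiteKNFace.lean`) and the site Lemma 9 face
estimate (`SiteKN.exists_forall_lt_real_siteLinked_orthantFace`, ibid.; `SiteKN.siteLinkedOrthantFace_of_theta`,
`Transplant/SiteKNUnconditional.lean`) — fed into blocks (β)/(γ) — site Lemmas 11–12, the
site exploration scheme on the star carrier, its lawfulness and exit lemma, and site Theorem A below density one
(`SiteKN.SKSch.siteSamePWitnessLtOneZd_of_inputs` / `sitePercolationContinuity_of_inputs`, prim-hp-8 gen 19,
`Transplant/SiteKNWitness.lean`; the socket at `p = 1` by prim-bschramm p1 gen 4, `Transplant/SiteSamePWitnessAtOne.lean`).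

* **`siteSamePWitnessLtOneZd_holds (hd : 3 ≤ d)`**, **`siteSamePWitnessZd_holds (hd : 3 ≤ d)`** — both site sockets of the
  lane (`SiteSameP.SiteSamePWitnessLtOneZd d`, p1 gen 3; `SiteSameP.SiteSamePWitnessZd d`, V18 socket p217536 — the `p = 1`
  clause by p1 gen 4's single-vertex scheme, `SiteSameP.siteSamePWitnessZd_of_ltOne`) HOLD on `ℤ^d`, `d ≥ 3`;
* **`sitePercolationContinuity_holds (hd : 3 ≤ d) : SitePercolationContinuity d`** — `θ^{site}_{ℤ^d}(p_c^{site}(ℤ^d)) = 0`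
  for every `d ≥ 3`, closed term, standard axioms;
* **`sitePercolationContinuityZ3_holds : SitePercolationContinuityZ3`** — the lane's class-C1a target (Benjamini–Schramm
  Conj. 4 for site percolation on `ℤ³`): a NEW theorem (site `θ(p_c) = 0` is open in print for `3 ≤ d < d₀(site)`).
Helper file (`--supports stmt-CriticalPhenomena-4575`); no sorries, no named-fact hypotheses.
[cite: KozmaNitzan2024, §1 p. 2 (approach 1), §4 Theorem 6 (pp. 25–31)] [cite: BenjaminiSchramm1996, Conj. 4]
[cite: GrimmettPercolation1999, §1.6]
-/

noncomputable section

namespace Summit.CriticalPhenomena.PercolationContinuityZ3.Theorems.Transplant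

namespace SiteKN

open MeasureTheory ProbabilityTheory
open Literature.Probability.Percolation Literature.Probability.LatticeModels

variable {d : ℕ}

/-- **The site same-`p` witness below one holds on `ℤ^d`, `d ≥ 3`** (p1's socket `SiteSameP.SiteSamePWitnessLtOneZd`,
closed term): at every `0 < p < 1` with `θ^{site}(p) > 0` the site exploration scheme of Kozma–Nitzan §4 on the star carrier,
lawful at `(p, 2⁻³³)`, bounded range, whose infinite macro-cluster forces `0 ↔^{site} ∞`.
[cite: KozmaNitzan2024, §4 Theorem 6 (pp. 25–31)] -/
theorem siteSamePWitnessLtOneZd_holds (hd : 3 ≤ d) : SiteSameP.SiteSamePWitnessLtOneZd d := by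
  haveI : NeZero d := ⟨by omega⟩
  exact SKSch.siteSamePWitnessLtOneZd_of_inputs hd
    (fun p hp0 hp1 hθ => siteTargetProperty_of_theta p hp0 hp1 hθ)
    (fun p _ hp1 hθ => siteLinkedOrthantFace_of_theta p hθ hp1)

/-- **The lane's V18 site socket holds on `ℤ^d`, `d ≥ 3`**: `SiteSameP.SiteSamePWitnessZd d` (p217536) — below one by
`siteSamePWitnessLtOneZd_holds`, at `p = 1` by the single-vertex scheme (`SiteSameP.siteSamePWitnessZd_of_ltOne`, p1 gen 4).
[cite: KozmaNitzan2024, §4 p. 25 (Definition of an exploration process)] -/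
theorem siteSamePWitnessZd_holds (hd : 3 ≤ d) : SiteSameP.SiteSamePWitnessZd d :=
  SiteSameP.siteSamePWitnessZd_of_ltOne (by omega) (siteSamePWitnessLtOneZd_holds hd)

/-- **`θ^{site}_{ℤ^d}(p_c^{site}(ℤ^d)) = 0` for every `d ≥ 3`** (closed term): the SITE analogue of the p205010 conjunct, by the
site re-typing of Kozma–Nitzan §4 (site Conj. 3 ⇒ site Lemma 10 ⇒ lawful bounded-range site scheme at every percolating
`p < 1`) and the same-`p` continuation principle (site Theorem A). [cite: BenjaminiSchramm1996, Conj. 4] -/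
theorem sitePercolationContinuity_holds (hd : 3 ≤ d) : SitePercolationContinuity d :=
  SiteSameP.sitePercolationContinuity_of_siteSamePWitnessLtOneZd d (by omega) (siteSamePWitnessLtOneZd_holds hd)

/-- **Benjamini–Schramm's Conjecture 4 for SITE percolation on `ℤ³`: `θ^{site}_{ℤ³}(p_c^{site}(ℤ³)) = 0`** — the lane's
class-C1a target, closed. [cite: BenjaminiSchramm1996, Conj. 4] -/
theorem sitePercolationContinuityZ3_holds : SitePercolationContinuityZ3 :=
  sitePercolationContinuity_holds le_rfl

end SiteKN

end Summit.CriticalPhenomena.PercolationContinuityZ3.Theorems.Transplant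

end
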